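import Literature.NumberTheory.EllipticCurves.HeegnerPointsKolyvaginProp81FrobeniusProofs
import Literature.NumberTheory.QuadraticFields.HeegnerCondition
import Mathlib.NumberTheory.RamificationInertia.Unramified
import HarnessLib

/-!
# SPLIT ⇒ UNRAMIFIED: a rational prime with two primes above it in a quadratic field is unramified
# there, read on the places `v` of `𝓞 ℚ` (the `hKunr` binder of the Kolyvagin `h44` chain); and
# the Heegner hypothesis supplies it at every `p ∣ N` (cell `b2b-bsdres`, team N8/O2 = X11b @ 3, seat
# `b2b-bsdres-x11b3-p7` GEN 7, lead GEN 9 deal R10-59 (B3a); theorems only)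

HONEST FRAMING (cell `b2b-bsdres`, run/shared/lean/b2b/bsd-rank1-residual/, verbatim in every
file): the goal of the cell is to DELETE the COMBINATION-SHAPED residual classes of the
Birch–Swinnerton-Dyer formula for ALL analytic-rank `≤ 1` elliptic curves over `ℚ` — assembled
STRICTLY from published theorems — so that the rank-`≤ 1` remainder becomes exactly the
CONSTRUCTION-SHAPED classes, which are TYPED, NOT attempted. This is not "finishing BSD". Team N8/O2
(X11b at `3`): PLUMBING for the concrete Kolyvagin `h44`-at-divisors chain — this file discharges
NOTHING on the residual map (`h37` / `h44` / (γ) untouched; (γ) stays cite-only, NOT a fact); nothing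
booked; no mark / label / count / tier; O2 OPEN / N8 CONSTRUCTION. THEOREMS ONLY (no definition, no
named fact, no `sorry`); generic `p` and `K`, nothing `p = 3`-specific.

## What this file proves (folklore `∑ eᵢ fᵢ = n`: two primes above `p` in a quadratic field force
## `e = f = 1`)

* `isUnramifiedIn_of_ncard_primesOver_eq_two` — `K` a number field with `[K : ℚ] = 2`, `p` a rational
  prime with `((p) ⊂ ℤ).primesOver (𝓞 K)` of cardinality `2`: for every place `v` of `𝓞 ℚ`
  containing `p`, `Algebra.IsUnramifiedIn (𝓞 K) v.asIdeal` — character for character the `hKunr`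
  binder of x11b3-p4's `InertiaTransport` END
  `torsionBy_ringClassField_eq_bot_of_hasIrreducibleModPGaloisRep` / `isAdmissible_pointsSubgroup_of_…`
  (p295254 / p296025) and of the x11b3-p8 lineage's third `KolyvaginH44AtThree` END.
* `isUnramifiedIn_of_satisfiesHeegnerHypothesis_of_dvd` — for `K` imaginary quadratic satisfying the
  Heegner hypothesis for `N` (`SatisfiesHeegnerHypothesis N K`: every `p ∣ N` splits) and a prime
  `p ∣ N`: the same conclusion. At `3 ∣ N` this is the consumer's discharge of `hKunr` at `p = 3`.

What is NEW here is only the RE-BASING `ℤ → 𝓞 ℚ`: the `ℤ`-based statements are tree theorems —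
`Literature.NumberTheory.QuadraticFields.SplitPrime.ramificationIdx_eq_one_of_ncard_primesOver`
(`e = f = 1` at every prime above a totally split `p`, from Mathlib's fundamental identity
`Ideal.sum_ramification_inertia`) and
`Literature.NumberTheory.GaloisRepresentations.splitsCompletely_of_ncard_primesOver_eq_two`
(`Algebra.IsUnramifiedIn (𝓞 K) (span {(p : ℤ)})`) — while the consumers quantify over
`v : HeightOneSpectrum (𝓞 ℚ)` and ask `Algebra.IsUnramifiedIn (𝓞 K) v.asIdeal`. The bridge: the old
ramification index `ramificationIdx' p P = sSup {n | p·𝓞_K ≤ P ^ n}` only sees the extended ideal,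
and `v·𝓞_K = p·𝓞_K = (p)ℤ·𝓞_K` (`span_natCast_rat_eq`); then Mathlib's
`Ideal.ramificationIdx'_eq_ramificationIdx` and `Algebra.isUnramifiedIn_iff_forall_ramificationIdx_eq_one`
— the closing moves of the INERT sibling `isUnramifiedIn_of_span_natCast_isPrime`
(`HeegnerPointsKolyvaginProp81FrobeniusProofs`), next to which this SPLIT sibling sits.

References: D. A. Marcus, *Number Fields*, 2nd ed. (2018), Ch. 3 Thm. 21 and Ch. 4 (before Thm. 29)
[Marcus2018]; J. Neukirch, *Algebraic Number Theory* (1999), Ch. I §8 Prop. (8.2) [NeukirchANT1999];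
B. H. Gross, *Kolyvagin's work on modular elliptic curves* (1991), §1 (the Heegner hypothesis: "all
prime factors of `N` are split") [GrossLMS1991].
-/

noncomputable section

open scoped Classical
open NumberField IsDedekindDomain Ideal
open Literature.NumberTheory.EllipticCurves Literature.NumberTheory.GaloisRepresentations

namespace Summit.BirchSwinnertonDyer.Rank1Residual.X11b

variable {K : Type*} [Field K] [NumberField K]

/-- **SPLIT ⇒ UNRAMIFIED, on the places of `𝓞 ℚ`.** If `[K : ℚ] = 2` and the rational prime `p`
has two primes of `𝓞 K` above it, then every place `v ∋ p` of `𝓞 ℚ` is unramified in `K`: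
`∑ eᵢ fᵢ = 2` with two summands forces `e = 1` at each prime above `p` (tree lemma
`SplitPrime.ramificationIdx_eq_one_of_ncard_primesOver`, over `ℤ`), and the ramification index over
`v ⊂ 𝓞 ℚ` is the one over `(p) ⊂ ℤ` because both extend to `p·𝓞 K`. Plumbing; folklore.
[cite: Marcus2018, Ch. 4 (before Thm. 29)] -/
theorem isUnramifiedIn_of_ncard_primesOver_eq_two (hK2 : Module.finrank ℚ K = 2) {p : ℕ}
    (hp : p.Prime) (hsplit : ((Ideal.span {(p : ℤ)}).primesOver (𝓞 K)).ncard = 2) :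
    ∀ v : HeightOneSpectrum (𝓞 ℚ), (p : 𝓞 ℚ) ∈ v.asIdeal →
      Algebra.IsUnramifiedIn (𝓞 K) v.asIdeal := by
  intro v hpv
  rw [Algebra.isUnramifiedIn_iff_forall_ramificationIdx_eq_one]
  intro P _ hP
  -- `P ∋ p`, so `P` lies over `(p) ⊂ ℤ` as well
  have hpP : (p : 𝓞 K) ∈ P := by
    have h1 : (p : 𝓞 ℚ) ∈ P.under (𝓞 ℚ) := by rw [← hP.over]; exact hpv
    rw [under_def, mem_comap, map_natCast] at h1
    exact h1
  have hPne : P ≠ ⊥ := ne_bot_of_liesOver_of_ne_bot v.ne_bot P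
  haveI : P.LiesOver (span {(p : ℤ)}) := by
    haveI hmax : (span {(p : ℤ)}).IsMaximal :=
      ((span_singleton_prime (by exact_mod_cast hp.ne_zero)).mpr
        (Nat.prime_iff_prime_int.mp hp)).isMaximal
          (by rw [ne_eq, span_singleton_eq_bot]; exact_mod_cast hp.ne_zero)
    refine ⟨hmax.eq_of_le (comap_ne_top _ (Ideal.IsPrime.ne_top inferInstance)) ?_⟩
    rw [span_singleton_le_iff_mem, mem_comap, map_natCast]
    exact hpP
  -- `e(P | (p)ℤ) = 1` from the fundamental identity with two primes above `p`
  obtain ⟨heZ, -⟩ :=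
    Literature.NumberTheory.QuadraticFields.SplitPrime.ramificationIdx_eq_one_of_ncard_primesOver
      hp (hsplit.trans hK2.symm) (P := P) ⟨inferInstance, inferInstance⟩
  -- re-base: both indices are `sSup {n | p·𝓞 K ≤ P ^ n}`
  haveI := hP
  rw [← Ideal.ramificationIdx'_eq_ramificationIdx v.asIdeal P v.ne_bot]
  have hmapQ : v.asIdeal.map (algebraMap (𝓞 ℚ) (𝓞 K)) = span {(p : 𝓞 K)} := by
    rw [← span_natCast_rat_eq hp hpv, Ideal.map_span, Set.image_singleton, map_natCast]
  have hmapZ : (span {(p : ℤ)}).map (algebraMap ℤ (𝓞 K)) = span {(p : 𝓞 K)} := by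
    rw [Ideal.map_span, Set.image_singleton, map_natCast]
  unfold Ideal.ramificationIdx' at heZ ⊢
  rw [hmapQ]
  rw [hmapZ] at heZ
  exact heZ

/-- **The Heegner hypothesis makes every `p ∣ N` unramified in `K`, on the places of `𝓞 ℚ`.** For `K`
imaginary quadratic with `SatisfiesHeegnerHypothesis N K` (Gross 1991, §1: "all prime factors of `N`
are split in `K`") and a prime `p ∣ N`: every place `v ∋ p` of `𝓞 ℚ` is unramified in `K`. This is
the discharge of the `hKunr` binder of the concrete `h44` chain at a Heegner datum of level `N` with
`p ∣ N` (at X11b @ 3: `3 ∣ N`). Plumbing. [cite: GrossLMS1991, §1 (p. 235)] -/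
theorem isUnramifiedIn_of_satisfiesHeegnerHypothesis_of_dvd (hK : IsImaginaryQuadratic K) {N p : ℕ}
    (hH : SatisfiesHeegnerHypothesis N K) (hp : p.Prime) (hpN : p ∣ N) :
    ∀ v : HeightOneSpectrum (𝓞 ℚ), (p : 𝓞 ℚ) ∈ v.asIdeal →
      Algebra.IsUnramifiedIn (𝓞 K) v.asIdeal :=
  isUnramifiedIn_of_ncard_primesOver_eq_two hK.1 hp (hH p hp hpN)

end Summit.BirchSwinnertonDyer.Rank1Residual.X11b

end
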